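import Literature.NumberTheory.LFunctions.MatomakiRadziwillTaoTheorem17
import Literature.NumberTheory.LFunctions.MatomakiRadziwillTaoPropA3
import Literature.NumberTheory.LFunctions.TaoLogElliottOfMRT
import Literature.NumberTheory.LFunctions.TaoLogChowlaTwoAssembly
import HarnessLib

/-!
# Tao's log-averaged Chowla–Elliott theorem from the complex Matomäki–Radziwiłł theorem alone

With Matomäki–Radziwiłł–Tao 2015, Theorem 1.7 proved from Theorem A.2
(`MRT2015.MatomakiRadziwillTao2015_theorem17_of_theoremA2`, `MatomakiRadziwillTaoTheorem17.lean`) and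
Theorem A.2 proved from Proposition A.3 (`MatomakiRadziwillTao2015_theoremA2_of_propA3`,
`MatomakiRadziwillTaoPropA3.lean`), the chain of the tree

  `MRT 2015 Prop A.3 ⟹ Thm A.2 ⟹ Thm 1.7 ⟹ Tao 2016 Prop 2.4 ⟹ Thm 2.3 ⟹ Thm 1.3 ⟹ Cor 1.5 ⟹ Thm 1.2 (λ, μ)`

(`TaoLogElliottOfMRT.lean`, `TaoLogChowlaTwoAssembly.lean` for everything after the second arrow)
reduces the named facts `tao_log_averaged_elliott_two` (Tao 2016, Thm 1.3), `Tao2016_theorem23`,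
`tao_log_chowla_two` (Thm 1.2 for `λ`, `μ` and all shifts),
`Literature.NumberTheory.Sieve.tao_log_chowla_liouville` (parity.S21) and
`Literature.NumberTheory.Sieve.tao_log_chowla_moebius` (`∑_{n ≤ x} μ(n)μ(n+h)/n = o(log x)`) to the
single named fact `Literature.NumberTheory.LFunctions.MatomakiRadziwillTao2015_theoremA2`
(Matomäki–Radziwiłł–Tao, Algebra & Number Theory 9 (2015), Theorem A.2 — the Matomäki–Radziwiłł
theorem for complex-valued multiplicative functions), and further to
`Literature.NumberTheory.LFunctions.MatomakiRadziwillTao2015_propA3` (ibid., Proposition A.3).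
Everything in this file is a one-line composition of theorems of the tree.

## References
* T. Tao, *The logarithmically averaged Chowla and Elliott conjectures for two-point
  correlations*, Forum Math. Pi 4 (2016), e8; arXiv:1509.05422: Theorems 1.2, 1.3, 2.3,
  Corollary 1.5, §1 (paragraph after Remark 1.6).
* K. Matomäki, M. Radziwiłł, T. Tao, *An averaged form of Chowla's conjecture*, Algebra & Number
  Theory 9 (2015), Theorem 1.7, Theorem A.2, Proposition A.3.
-/

namespace Literature.NumberTheory.LFunctions

/-- **Tao 2016, Theorem 2.3, from MRT 2015, Theorem A.2.** [cite: TaoFMP2016, Theorem 2.3] -/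
theorem Tao2016_theorem23_of_theoremA2 (hA2 : MatomakiRadziwillTao2015_theoremA2) :
    Tao2016_theorem23 :=
  Tao2016_theorem23_of_MRT (MRT2015.MatomakiRadziwillTao2015_theorem17_of_theoremA2 hA2)

/-- **Tao 2016, Theorem 1.3 (the logarithmically averaged Elliott conjecture for two-point
correlations), from MRT 2015, Theorem A.2**: the named fact `tao_log_averaged_elliott_two`
follows from the single named fact `MatomakiRadziwillTao2015_theoremA2`.
[cite: TaoFMP2016, Theorem 1.3] -/
theorem tao_log_averaged_elliott_two_of_theoremA2 (hA2 : MatomakiRadziwillTao2015_theoremA2) :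
    tao_log_averaged_elliott_two :=
  tao_log_averaged_elliott_two_of_MRT (MRT2015.MatomakiRadziwillTao2015_theorem17_of_theoremA2 hA2)

/-- **Tao 2016, Theorem 1.2 for general shifts (`λ` and `μ`), from MRT 2015, Theorem A.2.**
[cite: TaoFMP2016, Theorem 1.2 and Corollary 1.5] -/
theorem tao_log_chowla_two_of_theoremA2 (hA2 : MatomakiRadziwillTao2015_theoremA2) :
    tao_log_chowla_two :=
  tao_log_chowla_two_of_MRT (MRT2015.MatomakiRadziwillTao2015_theorem17_of_theoremA2 hA2)

/-- **parity.S21 (Liouville), from MRT 2015, Theorem A.2.** [cite: TaoFMP2016, Theorem 1.2] -/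
theorem tao_log_chowla_liouville_of_theoremA2 (hA2 : MatomakiRadziwillTao2015_theoremA2) :
    Sieve.tao_log_chowla_liouville :=
  tao_log_chowla_liouville_of_MRT (MRT2015.MatomakiRadziwillTao2015_theorem17_of_theoremA2 hA2)

/-- **Tao 2016, (1.2) for the Möbius function (`∑_{n ≤ x} μ(n)μ(n+h)/n = o(log x)`), from MRT 2015,
Theorem A.2**: the named fact `Literature.NumberTheory.Sieve.tao_log_chowla_moebius` follows from the
single named fact `MatomakiRadziwillTao2015_theoremA2`.
[cite: TaoFMP2016, §1 (paragraph after Remark 1.6)] -/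
theorem tao_log_chowla_moebius_of_theoremA2 (hA2 : MatomakiRadziwillTao2015_theoremA2) :
    Sieve.tao_log_chowla_moebius :=
  tao_log_chowla_moebius_of_MRT (MRT2015.MatomakiRadziwillTao2015_theorem17_of_theoremA2 hA2)

/-- **Tao 2016, Theorem 1.3, from MRT 2015, Proposition A.3.** [cite: TaoFMP2016, Theorem 1.3] -/
theorem tao_log_averaged_elliott_two_of_propA3 (hA3 : MatomakiRadziwillTao2015_propA3) :
    tao_log_averaged_elliott_two :=
  tao_log_averaged_elliott_two_of_theoremA2 (MatomakiRadziwillTao2015_theoremA2_of_propA3 hA3)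

/-- **Tao 2016, Theorem 1.2 for general shifts, from MRT 2015, Proposition A.3.**
[cite: TaoFMP2016, Theorem 1.2 and Corollary 1.5] -/
theorem tao_log_chowla_two_of_propA3 (hA3 : MatomakiRadziwillTao2015_propA3) :
    tao_log_chowla_two :=
  tao_log_chowla_two_of_theoremA2 (MatomakiRadziwillTao2015_theoremA2_of_propA3 hA3)

/-- **parity.S21 (Liouville) from MRT 2015, Proposition A.3.** [cite: TaoFMP2016, Theorem 1.2] -/
theorem tao_log_chowla_liouville_of_propA3 (hA3 : MatomakiRadziwillTao2015_propA3) :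
    Sieve.tao_log_chowla_liouville :=
  tao_log_chowla_liouville_of_theoremA2 (MatomakiRadziwillTao2015_theoremA2_of_propA3 hA3)

/-- **`∑_{n ≤ x} μ(n)μ(n+h)/n = o(log x)` from MRT 2015, Proposition A.3**: the named fact
`Literature.NumberTheory.Sieve.tao_log_chowla_moebius` follows from the single named fact
`MatomakiRadziwillTao2015_propA3`. [cite: TaoFMP2016, §1 (paragraph after Remark 1.6)] -/
theorem tao_log_chowla_moebius_of_propA3 (hA3 : MatomakiRadziwillTao2015_propA3) :
    Sieve.tao_log_chowla_moebius :=
  tao_log_chowla_moebius_of_theoremA2 (MatomakiRadziwillTao2015_theoremA2_of_propA3 hA3)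

end Literature.NumberTheory.LFunctions
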